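import Summits.Ventures.QEC.CircuitDistance.PortK2DataBB144Z
import Summits.Ventures.QEC.CircuitDistance.K2Chunks
import HarnessLib

/-!
# K2(`[[144,12,12]]`) chunk module — COMPUTATIONAL (native_decide; `Lean.ofReduceBool`)

Cell `qec`, CDX, R146/R152 STEP 1 («computational» header; `ofReduceBool` confined to these chunk modules). Checker of record
`K2.K2Data` (qec-cdx-type-1, PortK2Check); data module of record `PortK2DataBB144X/Z` (p669158/9, crit-1 data audit PASS
2026-08-28T21:20Z); chunk glue `K2Chunks` (idea-1 g2). Cube 0, child 12: leaf group 10 of 11.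
Leaf theorems: the K2 DFS accepts below one descendant state of pivot cube 0 (sector Z); sizes are exact DFS visit counts
(eng-1 g2 `k2count.c`), capped so that the gate's native-axiom audit re-verifies every leaf in place. Assemblies re-derive the
child lists in the kernel (`decide`) and end in the literal cube fact `d144Z.cube (Ts144Z.getD 0 []) (0) (lives144Z.getD 0 0) = true`
(the `hcubes` hypothesis of `K2Inst.k2_complete`). Emitted by qec-cdx-eng-1 g2 (`gen2.py`, idea-1's `gen_k2chunks_from_lean.py` lineage).
-/

namespace Summit.Ventures.QEC.CircuitDistance.K2

set_option maxRecDepth 100000 in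
set_option maxHeartbeats 0 in
set_option exponentiation.threshold 1024 in
/-- K2(144) chunk fact `cube144Z0_ch12_15` (560354 DFS visits; see the module docstring). -/
theorem cube144Z0_ch12_15 : app5 (d144Z.dfs (Ts144Z.getD 0 []) 6) (1180591902194671814912, 2064, 3618502795406117773774253230188250892169594689210553731868192620523187863553, 3, 2348542582773833227889480596789333352332903607868065130141607763844511324073757698226536576160300391374782428) = true := by native_decide

set_option maxRecDepth 100000 in
set_option maxHeartbeats 0 in
set_option exponentiation.threshold 1024 in
/-- K2(144) chunk fact `cube144Z0_ch12_16` (596571 DFS visits; see the module docstring). -/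
theorem cube144Z0_ch12_16 : app5 (d144Z.dfs (Ts144Z.getD 0 []) 6) (1478045685565326622976, 1688, 3978585891278293137249797971841354380752315960150536647192121101250911119220542906826753, 3, 2348542582773833227885502010898055059195660549882890563420804114638132542334233986411391300184200124370517980) = true := by native_decide

set_option maxRecDepth 100000 in
set_option maxHeartbeats 0 in
set_option exponentiation.threshold 1024 in
/-- K2(144) chunk fact `cube144Z0_ch12_17` (1 DFS visits; see the module docstring). -/
theorem cube144Z0_ch12_17 : app5 (d144Z.dfs (Ts144Z.getD 0 []) 6) (0, 0, 31828687130226345097951203868063321426377860404802008823858103807267842951922411936677889, 3, 2348542582773833227853673323767828714097716086001494029654374920987102288418044291890229092375397988336402396) = true := by decide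

set_option maxRecDepth 100000 in
set_option maxHeartbeats 0 in
set_option exponentiation.threshold 1024 in
/-- K2(144) chunk fact `cube144Z0_ch12_18` (638615 DFS visits; see the module docstring). -/
theorem cube144Z0_ch12_18 : app5 (d144Z.dfs (Ts144Z.getD 0 []) 6) (1180627930989407011136, 336, 4074071952668972172536898116805423109762885454085644256179949307994868234669793688269357057, 3, 2348542582773833223779601371098856541560824709182737707551438133655229787145763393181466492848724575969607644) = true := by native_decide
end Summit.Ventures.QEC.CircuitDistance.K2
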